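/-
Copyright (c) 2026 the pub-hodgecm-mathlib formalisation cell (harness21).  Prover seat hodgecm-mathlib-K2E5-p17 (g7), Track B «K2-LIT» ∕ hLiu418
#184♮, socket #42S organ S1 (ROAD W), brick F7 (W2) — the INERT READING of the frame coordinate (K2Liu-p01 (g9) 14:04:39Z∕14:10:50Z cut «(K-tot)
`K2LiuInertWitnessCoordinate` = the `hK2`∕`κ` letter of ★ (W2-c)∕(W2-d)»).  2026-09-04.  KERNEL: theorems only.
-/
import Summits.HodgeConjecture.HodgeConjecture.Theorems.K2LiuWitnessFrameCoordinateContinuous   -- ★ (K3) (K2Liu-p08): `exists_frame_homeomorph` (generic `R`, `σ`)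
import Literature.NumberTheory.GelbartRogawski1991.LocalDoubledUnitaryIwahori                   -- ★ `LocalRing.evalEquiv` (`E ⊗ F_v ≃+* E_{w₀}` at a non-split place)
import Literature.NumberTheory.Automorphic.UnitaryGroupNonsplitPlace                            -- ★ `PlacesOver.eq_of_smul_eq` (one place above a non-split `v`)
import HarnessLib

/-!
# Crux `HLiu418`, #42S-S1 ROAD W, brick F7 (W2): THE FRAME COORDINATE READ AT THE INERT PLACE `w₀`

Cell `hodgecm-mathlib`, crux item hLiu418 = `stmt-HodgeConjecture-24832` (helper lane `--supports … --as helper`, count-neutral).  THEOREMS ONLY (no `def`, no instance,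
no notation, no named-fact hypothesis, no `sorry`).

At a place `v` of `F` that does NOT split in `E` (`c • w₀ = w₀` for the place `w₀ ∣ v`, `c ≠ 1`) the local algebra `E ⊗_F F_v = ∏_{w ∣ v} E_w` IS `K := E_{w₀}`
(★ `LocalRing.evalEquiv`, evaluation at the unique `w₀`), and `c ⊗ 1` read at `w₀` is `σ_{w₀} := galAdicCompletionMap c hw₀`.  The Y-model coordinate
`κ₀ : Y ≃+ (ι′ → E ⊗ F_v)` (continuous both ways) therefore becomes `κ₀′ : Y ≃+ (ι′ → K)` (continuous both ways: `§1`), and the GENERIC frame coordinate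
★ `K2LiuWitnessFrameCoordinateContinuous.exists_frame_homeomorph` (over the topological ring `K` with `σ_{w₀}` and a frame `P` of the Gram `D` READ AT `w₀`) gives
★★ HEAD **`exists_inert_frame_homeomorph`**: a homeomorphic additive equivalence `κ : Y ≃+ (Fin 2 → K)³` with the Gram identity
`(Σ_k Σ_l κ₀ x (e(j,l))·D_{kl}·(c ⊗ 1)(κ₀ x (e(i,k))))(w₀) = (A σ(B)ᵀ + B σ(A)ᵀ + d_K·C σ(C)ᵀ)_{ji}`, `(A, B, C) = κ x` — the `hK2` binder of ★ (W2-c)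
`setOf_forall_inter_preimage_diff_eq` ∕ ★ (W2-d) `sum_profile_eq_shape_inert` VERBATIM once `G̃ x := Matrix.of (j i ↦ Σ_k Σ_l …)` (`Matrix.of_apply`).
Also `exists_inert_frame_homeomorph_frame` (the same with the frame identity (K1) `![(κ x).1 j, (κ x).2.1 j, (κ x).2.2 j] ᵥ* P = (l ↦ κ₀ x (e (j,l)) w₀)` kept).
[Shimura1997, §13.2] [Scharlau1985HermitianForms, Ch. 7 §1] [CasselsFrohlichANT1967, Ch. II §10].
HONEST LABEL.  Count-neutral helper; `HC_CM` is proved only modulo the 7 printed citations (2 remaining named inputs: hLiu418 = `stmt-HodgeConjecture-24832`,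
h413 = `stmt-HodgeConjecture-24833`) until rung 0 closes.

## References
* [Shimura1997] G. Shimura, *Euler products and Eisenstein series*, CBMS 93 (1997), §13.2.
* [Scharlau1985HermitianForms] W. Scharlau, *Quadratic and Hermitian Forms*, Grundlehren 270 (1985), Ch. 7 §1.
* [CasselsFrohlichANT1967] J. W. S. Cassels, A. Fröhlich (eds.), *Algebraic Number Theory* (1967), Ch. II §10.
-/

set_option autoImplicit false
set_option linter.dupNamespace false -- the mandated namespace repeats `HodgeConjecture.HodgeConjecture`

open Matrix NumberField IsDedekindDomain

namespace Summit.HodgeConjecture.HodgeConjecture.Cruxes.HLiu418.K2LiuInertWitnessCoordinate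

open Literature.NumberTheory.Automorphic Literature.NumberTheory.Automorphic.UnitaryGroup
open Literature.NumberTheory.GelbartRogawski1991.UnitaryDualPair.LocalSplitting
open Summit.HodgeConjecture.HodgeConjecture.Cruxes.HLiu418.K2LiuWitnessFrameCoordinateContinuous (exists_frame_homeomorph)

variable {F E : Type} [Field F] [NumberField F] [Field E] [NumberField E] [Algebra F E] [Algebra.IsQuadraticExtension F E]
  (c : E ≃ₐ[F] E) (hc : c ≠ 1) (v : HeightOneSpectrum (𝓞 F)) (w₀ : PlacesOver E v) (hw₀ : c • w₀.1 = w₀.1)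

/-! ## §1 `E ⊗ F_v = E_{w₀}` topologically, and `c ⊗ 1` read at `w₀` -/

/-- evaluation at `w₀` is continuous (the product topology on `E ⊗ F_v = ∏_{w ∣ v} E_w`). [cite: CasselsFrohlichANT1967, Ch. II §10] -/
theorem continuous_evalEquiv : Continuous (LocalRing.evalEquiv F E c v hc w₀ hw₀) :=
  continuous_apply w₀

/-- … and so is its inverse: `w₀` is the ONLY place above `v`, so every coordinate of `evalEquiv⁻¹ y` is `y`. [cite: CasselsFrohlichANT1967, Ch. II §10] -/
theorem continuous_evalEquiv_symm : Continuous (LocalRing.evalEquiv F E c v hc w₀ hw₀).symm := by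
  refine continuous_pi fun w => ?_
  obtain rfl : w = w₀ := PlacesOver.eq_of_smul_eq c hc w₀ hw₀ w
  have h : (fun y => (LocalRing.evalEquiv F E c v hc w hw₀).symm y w) = id :=
    funext fun y => (LocalRing.evalEquiv F E c v hc w hw₀).apply_symm_apply y
  rw [h]
  exact continuous_id

include hc in
/-- `((c ⊗ 1) x)(w₀) = σ_{w₀} (x w₀)` at a non-split place (`w₀` is the only place above `v`). [cite: CasselsFrohlichANT1967, Ch. II §10] -/
theorem conjLocal_apply_eq (x : LocalRing E v) : conjLocal E c v x w₀ = galAdicCompletionMap (L := E) c hw₀ (x w₀) := by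
  have key : ∀ (w₁ : PlacesOver E v) (h₁ : c • w₁.1 = w₀.1), galAdicCompletionMap (L := E) c h₁ (x w₁) = galAdicCompletionMap (L := E) c hw₀ (x w₀) := by
    intro w₁ h₁
    obtain rfl : w₁ = w₀ := PlacesOver.eq_of_smul_eq c hc w₀ hw₀ w₁
    rfl
  rw [conjLocal_apply]
  exact key ⟨c⁻¹ • w₀.1, under_inv_smul_eq c w₀⟩ (smul_inv_smul c w₀.1)

omit [Algebra.IsQuadraticExtension F E] in
/-- the frame Gram read at `w₀`: evaluation is a ring map through the double sum. [folklore] -/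
theorem gram_apply_eval {Y : Type*} {ι' : Type*} (κ₀ : Y → ι' → LocalRing E v) (e : Fin 2 × Fin 3 ≃ ι') (D : Matrix (Fin 3) (Fin 3) (LocalRing E v))
    (x : Y) (j i : Fin 2) :
    (∑ k, ∑ l, κ₀ x (e (j, l)) * D k l * conjLocal E c v (κ₀ x (e (i, k)))) w₀ =
      ∑ k, ∑ l, κ₀ x (e (j, l)) w₀ * D k l w₀ * conjLocal E c v (κ₀ x (e (i, k))) w₀ := by
  simp only [Finset.sum_apply, Pi.mul_apply]

/-! ## §2 THE FRAME COORDINATE AT THE INERT PLACE -/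

include hc in
/-- **THE FRAME COORDINATE AT THE INERT PLACE, WITH THE FRAME IDENTITY** (K1 kept).  For `κ₀ : Y ≃+ (ι′ → E ⊗ F_v)` continuous both ways, `e : Fin 2 × Fin 3 ≃ ι′`,
the diagonal-basis Gram `D` over `E ⊗ F_v` and a frame `P ∈ M₃(E_{w₀})`, `IsUnit P.det`, `P·D(w₀)ᵀ·σ_{w₀}(P)ᵀ = [[0,1,0],[1,0,0],[0,0,d_K]]`: there is
`κ : Y ≃+ (Fin 2 → E_{w₀})³`, continuous with continuous inverse, with (K1) `![(κ x).1 j, (κ x).2.1 j, (κ x).2.2 j] ᵥ* P = (l ↦ κ₀ x (e (j,l)) w₀)` and the Gram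
identity `(Σ_k Σ_l κ₀ x (e(j,l))·D_{kl}·(c ⊗ 1)(κ₀ x (e(i,k))))(w₀) = (A σ(B)ᵀ + B σ(A)ᵀ + d_K·C σ(C)ᵀ)_{ji}`.
[cite: Shimura1997, §13.2] [cite: Scharlau1985HermitianForms, Ch. 7 §1] -/
theorem exists_inert_frame_homeomorph_frame {Y : Type*} [AddCommGroup Y] [TopologicalSpace Y] {ι' : Type*} (κ₀ : Y ≃+ (ι' → LocalRing E v))
    (hκ₀ : Continuous κ₀) (hκ₀' : Continuous κ₀.symm) (e : Fin 2 × Fin 3 ≃ ι') (D : Matrix (Fin 3) (Fin 3) (LocalRing E v))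
    {P : Matrix (Fin 3) (Fin 3) (w₀.1.adicCompletion E)} {dK : w₀.1.adicCompletion E} (hPdet : IsUnit P.det)
    (hP : P * (D.map (Pi.evalRingHom (fun w : PlacesOver E v => w.1.adicCompletion E) w₀))ᵀ * (P.map (galAdicCompletionMap (L := E) c hw₀))ᵀ =
      !![0, 1, 0; 1, 0, 0; 0, 0, dK]) :
    ∃ κ : Y ≃+ (Fin 2 → w₀.1.adicCompletion E) × (Fin 2 → w₀.1.adicCompletion E) × (Fin 2 → w₀.1.adicCompletion E),
      Continuous κ ∧ Continuous κ.symm ∧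
      (∀ x j, ![(κ x).1 j, (κ x).2.1 j, (κ x).2.2 j] ᵥ* P = fun l => κ₀ x (e (j, l)) w₀) ∧
      ∀ x j i, (∑ k, ∑ l, κ₀ x (e (j, l)) * D k l * conjLocal E c v (κ₀ x (e (i, k)))) w₀ =
        (vecMulVec (κ x).1 (fun l => galAdicCompletionMap (L := E) c hw₀ ((κ x).2.1 l)) +
          vecMulVec (κ x).2.1 (fun l => galAdicCompletionMap (L := E) c hw₀ ((κ x).1 l)) +
          dK • vecMulVec (κ x).2.2 (fun l => galAdicCompletionMap (L := E) c hw₀ ((κ x).2.2 l))) j i := by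
  -- `κ₀′ := evalEquiv ∘ κ₀ : Y ≃+ (ι′ → K)`, continuous both ways (§1)
  let κ₀' : Y ≃+ (ι' → w₀.1.adicCompletion E) := κ₀.trans (AddEquiv.piCongrRight fun _ => (LocalRing.evalEquiv F E c v hc w₀ hw₀).toAddEquiv)
  have hκ₀'c : Continuous κ₀' := continuous_pi fun i => (continuous_apply w₀).comp ((continuous_apply i).comp hκ₀)
  have hκ₀'c' : Continuous κ₀'.symm := by
    have h1 : Continuous fun g : ι' → w₀.1.adicCompletion E => fun i => (LocalRing.evalEquiv F E c v hc w₀ hw₀).symm (g i) :=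
      continuous_pi fun i => (continuous_evalEquiv_symm c hc v w₀ hw₀).comp (continuous_apply i)
    exact hκ₀'.comp h1
  obtain ⟨κ, h1, h2, hκc, hκc'⟩ := exists_frame_homeomorph κ₀' hκ₀'c hκ₀'c' e (galAdicCompletionMap (L := E) c hw₀) hPdet hP
  refine ⟨κ, hκc, hκc', fun x j => h1 x j, fun x j i => ?_⟩
  rw [gram_apply_eval c v w₀ κ₀ e D x j i, ← h2 x j i]
  refine Finset.sum_congr rfl fun k _ => Finset.sum_congr rfl fun l _ => ?_
  rw [conjLocal_apply_eq c hc v w₀ hw₀]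
  rfl

include hc in
/-- **THE FRAME COORDINATE AT THE INERT PLACE** (HEAD; K2Liu-p01 (g9)'s `exists_inert_frame_homeomorph`, the `κ`∕`hK2` letter of ★ (W2-c)∕(W2-d) VERBATIM with
`G̃ x j i := Σ_k Σ_l κ₀ x (e(j,l))·D_{kl}·(c ⊗ 1)(κ₀ x (e(i,k)))`): `∃ κ : Y ≃+ (Fin 2 → E_{w₀})³` continuous with continuous inverse and
`(G̃ x j i)(w₀) = (A σ_{w₀}(B)ᵀ + B σ_{w₀}(A)ᵀ + d_K·C σ_{w₀}(C)ᵀ)_{ji}`, `(A, B, C) = κ x`.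
[cite: Shimura1997, §13.2] [cite: Scharlau1985HermitianForms, Ch. 7 §1] -/
theorem exists_inert_frame_homeomorph {Y : Type*} [AddCommGroup Y] [TopologicalSpace Y] {ι' : Type*} (κ₀ : Y ≃+ (ι' → LocalRing E v))
    (hκ₀ : Continuous κ₀) (hκ₀' : Continuous κ₀.symm) (e : Fin 2 × Fin 3 ≃ ι') (D : Matrix (Fin 3) (Fin 3) (LocalRing E v))
    {P : Matrix (Fin 3) (Fin 3) (w₀.1.adicCompletion E)} {dK : w₀.1.adicCompletion E} (hPdet : IsUnit P.det)
    (hP : P * (D.map (Pi.evalRingHom (fun w : PlacesOver E v => w.1.adicCompletion E) w₀))ᵀ * (P.map (galAdicCompletionMap (L := E) c hw₀))ᵀ =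
      !![0, 1, 0; 1, 0, 0; 0, 0, dK]) :
    ∃ κ : Y ≃+ (Fin 2 → w₀.1.adicCompletion E) × (Fin 2 → w₀.1.adicCompletion E) × (Fin 2 → w₀.1.adicCompletion E),
      Continuous κ ∧ Continuous κ.symm ∧
      ∀ x j i, (∑ k, ∑ l, κ₀ x (e (j, l)) * D k l * conjLocal E c v (κ₀ x (e (i, k)))) w₀ =
        (vecMulVec (κ x).1 (fun l => galAdicCompletionMap (L := E) c hw₀ ((κ x).2.1 l)) +
          vecMulVec (κ x).2.1 (fun l => galAdicCompletionMap (L := E) c hw₀ ((κ x).1 l)) +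
          dK • vecMulVec (κ x).2.2 (fun l => galAdicCompletionMap (L := E) c hw₀ ((κ x).2.2 l))) j i := by
  obtain ⟨κ, hκc, hκc', -, h2⟩ := exists_inert_frame_homeomorph_frame c hc v w₀ hw₀ κ₀ hκ₀ hκ₀' e D hPdet hP
  exact ⟨κ, hκc, hκc', h2⟩

end Summit.HodgeConjecture.HodgeConjecture.Cruxes.HLiu418.K2LiuInertWitnessCoordinate
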